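import Summits.HubbardSuperconductivity.HubbardSuperconductivity.Theses.FunctionFieldCertificate
import Summits.HubbardSuperconductivity.HubbardSuperconductivity.Theorems.FunctionFieldCertificateMesoscopicPairOrderDanskin
import Summits.HubbardSuperconductivity.HubbardSuperconductivity.Theorems.FunctionFieldCertificateMesoscopicPairOrderStubBoxExpectation
import Summits.HubbardSuperconductivity.HubbardSuperconductivity.Theorems.FunctionFieldCertificateMesoscopicPairOrderStubChordFloor
import Summits.HubbardSuperconductivity.HubbardSuperconductivity.Theorems.BalabanIRBirGappedPhaseReductionStructural
import Literature.Barriers.HubbardSuperconductivity.PureModelStripeCompetitionProofs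
import HarnessLib

/-!
# Crux `MesoscopicPairOrder` (stmt-HubbardSuperconductivity-7331), line `Sketch` (chord-floor half):
# the chord reduction is EXACT

Support file for the crux (route `FunctionFieldCertificate`, pole-free half). The line's skeleton
(`Cruxes/MesoscopicPairOrder/Lines/Sketch.lean`) closes the crux from its load-bearing stub
`stub_chordGap`, the stateless CHORD GAP of the box pair repulsion
`K_R = Σ_{x,y} W_R(y - x) • (P_xᴴ P_y)` (`W_R(z) = Πᵢ (1 - |zᵢ|_L/R)₊`,
`P_x = localPair dWaveFormFactor L x`, written inline):
`∃ (U, δ), m > 0, ∀R₀ ∃R ≥ R₀ ∃L₀ ∀ even L ≥ L₀ ∃ε > 0: ε · m · R² · L² ≤ E_K(H_L + ε K_R) - E_K(H_L)`,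
`K = szSector N_L 0`, `E_K = Matrix.minEnergyOn · K`. Here:

* `mesoscopicPairOrder_of_chordGap` — the composition with the stub as a hypothesis (upper chord
  inequality `stub_chordFloor` + bookkeeping `stub_boxExpectation`, both landed);
* `chordGap_of_mesoscopicPairOrder` — the CONVERSE (finite-dimensional Danskin,
  `exists_chord_ge_of_forall_ground` of `…MesoscopicPairOrderDanskin.lean`): the crux with margin `m`
  gives the chord gap with margin `m/2`;
* `mesoscopicPairOrder_iff_chordGap` — hence the registered load-bearing stub is EQUIVALENT to the
  crux: the line turns "a `d`-wave margin uniform over EVERY sector ground state" into a statement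
  about two sector ground ENERGIES per `(R, L)`, exactly, and that is all it does — the chord gap is
  the pole-free half of `d`-wave superconductivity in the pure 2D Hubbard model in stateless form.

Sources: Danskin (1967) Ch. I; Griffiths, J. Math. Phys. 5 (1964) 1215 §III; Tasaki (2020) §2.1.
Folklore; no definition is introduced.
-/

noncomputable section

-- the summit namespace `Summit.HubbardSuperconductivity.HubbardSuperconductivity.…` repeats the problem name by design (D-0017)
set_option linter.dupNamespace false

namespace Summit.HubbardSuperconductivity.HubbardSuperconductivity.Theorems.FunctionFieldCertificate

open Matrix Finset Filter
open Literature.Probability.LatticeModels Literature.MathematicalPhysics.QuantumLattice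
open Summit.HubbardSuperconductivity.HubbardSuperconductivity.Theses.FunctionFieldCertificate
open scoped ComplexOrder

/-! ### The crux and the chord gap of the box pair repulsion are equivalent -/

section Hubbard

/-- **Chord gap ⇒ crux** (the line's composition, with the load-bearing stub as a hypothesis). If at
some `U > 0`, `δ ∈ (0, 1/2)` there is `m > 0` such that for arbitrarily large `R` and all large even
`L` some coupling `ε > 0` has `ε · m · R² · L² ≤ E_K(H_L + εK_R) - E_K(H_L)`
(`K_R = Σ_{x,y} W_R(y - x) • (P_xᴴ P_y)` inline, `K = szSector N_L 0`), then `MesoscopicPairOrder`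
holds with the same data: by the upper chord inequality (`stub_chordFloor`) and the bookkeeping
`Re⟨ψ, K_R ψ⟩ = T_R(ψ)` (`stub_boxExpectation`), every normalised sector ground state `ψ` of `H_L`
has `ε m R² L² ≤ ε T_R(ψ)`. Tasaki (2020) §2.1. [folklore] -/
theorem mesoscopicPairOrder_of_chordGap
    (h : ∃ U : ℝ, 0 < U ∧ ∃ δ ∈ Set.Ioo (0:ℝ) (1 / 2), ∃ m : ℝ, 0 < m ∧
      ∀ R₀ : ℕ, ∃ R : ℕ, R₀ ≤ R ∧ ∃ L₀ : ℕ, ∀ (L : ℕ) [NeZero L], L₀ ≤ L → Even L → ∃ ε : ℝ, 0 < ε ∧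
        ε * (m * (R : ℝ) ^ 2 * (L : ℝ) ^ 2) ≤
          (hubbardTorus 2 L 1 U + (ε : ℂ) • (∑ x : TorusSite 2 L, ∑ y : TorusSite 2 L,
              ((∏ i : Fin 2, max 0 (1 - |(((y i - x i).valMinAbs : ℤ) : ℝ)| / (R : ℝ)) : ℝ) : ℂ) •
                ((localPair dWaveFormFactor L x)ᴴ * localPair dWaveFormFactor L y))).minEnergyOn
              (szSector (2 * ⌊(1 - δ) * (L : ℝ) ^ 2 / 2⌋₊) 0) -
            (hubbardTorus 2 L 1 U).minEnergyOn (szSector (2 * ⌊(1 - δ) * (L : ℝ) ^ 2 / 2⌋₊) 0)) :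
    MesoscopicPairOrder := by
  obtain ⟨U, hU, δ, hδ, m, hm, hall⟩ := h
  refine ⟨U, hU, δ, hδ, m, hm, fun R₀ => ?_⟩
  obtain ⟨R, hR₀, L₀, hL⟩ := hall R₀
  refine ⟨R, hR₀, L₀, ?_⟩
  intro L _ hL₀ hE ψ hψ hgs
  obtain ⟨ε, hε, hgap⟩ := hL L hL₀ hE
  have hchord := stub_chordFloor L U ε (2 * ⌊(1 - δ) * (L : ℝ) ^ 2 / 2⌋₊)
    (∑ x : TorusSite 2 L, ∑ y : TorusSite 2 L,
      ((∏ i : Fin 2, max 0 (1 - |(((y i - x i).valMinAbs : ℤ) : ℝ)| / (R : ℝ)) : ℝ) : ℂ) •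
        ((localPair dWaveFormFactor L x)ᴴ * localPair dWaveFormFactor L y)) ψ hε hψ hgs
  rw [stub_boxExpectation L R ψ] at hchord
  have hLpos : (0 : ℝ) < L := Nat.cast_pos.2 (Nat.pos_of_ne_zero (NeZero.ne L))
  have hL2 : (0 : ℝ) < (L : ℝ) ^ 2 := by positivity
  rw [le_div_iff₀ hL2]
  have := le_of_mul_le_mul_left (hgap.trans hchord) hε
  linarith

/-- **Crux ⇒ chord gap** (finite-dimensional Danskin; the reduction of the line is EXACT). If
`MesoscopicPairOrder` holds with data `(U, δ, m)`, then the chord gap holds with `(U, δ, m/2)`: at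
every scale `R ≥ 1` and even side `L` supplied by the crux, every normalised `(N_L, 0)`-sector ground
state `ψ` of `H_L = hubbardTorus 2 L 1 U` has `m R² L² ≤ T_R(ψ) = Re⟨ψ, K_R ψ⟩`
(`stub_boxExpectation`); `H_L` is Hermitian and preserves the sector, which contains a unit vector
(`exists_unit_isGroundStateInSector_hubbardTorus`), so `exists_chord_ge_of_forall_ground` with
`κ₀ = m R² L²`, `η = κ₀/2` gives `ε > 0` (depending on `L`) with
`ε · (m/2) · R² · L² ≤ E_K(H_L + εK_R) - E_K(H_L)`. Danskin (1967) Ch. I; Griffiths (1964) §III.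
[folklore] -/
theorem chordGap_of_mesoscopicPairOrder (h : MesoscopicPairOrder) :
    ∃ U : ℝ, 0 < U ∧ ∃ δ ∈ Set.Ioo (0:ℝ) (1 / 2), ∃ m : ℝ, 0 < m ∧
      ∀ R₀ : ℕ, ∃ R : ℕ, R₀ ≤ R ∧ ∃ L₀ : ℕ, ∀ (L : ℕ) [NeZero L], L₀ ≤ L → Even L → ∃ ε : ℝ, 0 < ε ∧
        ε * (m * (R : ℝ) ^ 2 * (L : ℝ) ^ 2) ≤
          (hubbardTorus 2 L 1 U + (ε : ℂ) • (∑ x : TorusSite 2 L, ∑ y : TorusSite 2 L,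
              ((∏ i : Fin 2, max 0 (1 - |(((y i - x i).valMinAbs : ℤ) : ℝ)| / (R : ℝ)) : ℝ) : ℂ) •
                ((localPair dWaveFormFactor L x)ᴴ * localPair dWaveFormFactor L y))).minEnergyOn
              (szSector (2 * ⌊(1 - δ) * (L : ℝ) ^ 2 / 2⌋₊) 0) -
            (hubbardTorus 2 L 1 U).minEnergyOn (szSector (2 * ⌊(1 - δ) * (L : ℝ) ^ 2 / 2⌋₊) 0) := by
  obtain ⟨U, hU, δ, hδ, m, hm, hall⟩ := h
  refine ⟨U, hU, δ, hδ, m / 2, by positivity, fun R₀ => ?_⟩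
  -- ask the crux for a scale `R ≥ max R₀ 1`, so that `κ₀ = m R² L² > 0`
  obtain ⟨R, hR₀, L₀, hL⟩ := hall (max R₀ 1)
  refine ⟨R, le_of_max_le_left hR₀, L₀, ?_⟩
  intro L _ hL₀ hE
  have hR1 : 1 ≤ R := le_of_max_le_right hR₀
  have hRpos : (0 : ℝ) < R := Nat.cast_pos.2 (lt_of_lt_of_le Nat.one_pos hR1)
  have hLpos : (0 : ℝ) < L := Nat.cast_pos.2 (Nat.pos_of_ne_zero (NeZero.ne L))
  have hL2 : (0 : ℝ) < (L : ℝ) ^ 2 := by positivity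
  set n₀ : ℕ := ⌊(1 - δ) * (L : ℝ) ^ 2 / 2⌋₊ with hn₀
  set H := hubbardTorus 2 L 1 U with hH
  set K : Submodule ℂ (Fock (Orb (FermionTorus 2 L))) := szSector (2 * n₀) 0 with hK
  set Y : Matrix (Finset (Orb (FermionTorus 2 L))) (Finset (Orb (FermionTorus 2 L))) ℂ :=
    ∑ x : TorusSite 2 L, ∑ y : TorusSite 2 L,
      ((∏ i : Fin 2, max 0 (1 - |(((y i - x i).valMinAbs : ℤ) : ℝ)| / (R : ℝ)) : ℝ) : ℂ) •
        ((localPair dWaveFormFactor L x)ᴴ * localPair dWaveFormFactor L y) with hY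
  -- the hypotheses of Danskin's lower bound
  have hHerm : H.IsHermitian := LiebThm1.hamiltonian_isHermitian (fermionTorusGraph 2 L) 1 U
  have hHK : ∀ v ∈ K, H *ᵥ v ∈ K := fun v hv => szSector_invariant_hubbardTorus 2 L 1 U n₀ hv
  have hKunit : ∃ ψ ∈ K, star ψ ⬝ᵥ ψ = 1 := by
    obtain ⟨ψ, hψ1, hψK, -, -⟩ :=
      Literature.Barriers.HubbardSuperconductivity.exists_unit_isGroundStateInSector_hubbardTorus U L
        n₀ (Literature.Barriers.HubbardSuperconductivity.natFloor_filling_le_sq (by linarith [hδ.1]) L)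
    exact ⟨ψ, hψK, hψ1⟩
  have hκ : 0 < m * (R : ℝ) ^ 2 * (L : ℝ) ^ 2 / 2 := by positivity
  have hground : ∀ ψ ∈ K, star ψ ⬝ᵥ ψ = 1 → H *ᵥ ψ = ((H.minEnergyOn K : ℝ) : ℂ) • ψ →
      m * (R : ℝ) ^ 2 * (L : ℝ) ^ 2 ≤ (star ψ ⬝ᵥ Y *ᵥ ψ).re := by
    intro ψ hψK hψ1 heig
    have hne : ψ ≠ 0 := by
      rintro rfl
      simp at hψ1
    have hcrux := hL L hL₀ hE ψ hψ1 ⟨hψK, hne, heig⟩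
    rw [le_div_iff₀ hL2] at hcrux
    rw [hY, stub_boxExpectation L R ψ]
    linarith
  obtain ⟨ε, hε, hgap⟩ :=
    exists_chord_ge_of_forall_ground hHerm Y K hHK hKunit hκ hground
  refine ⟨ε, hε, ?_⟩
  have : ε * (m / 2 * (R : ℝ) ^ 2 * (L : ℝ) ^ 2) =
      ε * (m * (R : ℝ) ^ 2 * (L : ℝ) ^ 2 - m * (R : ℝ) ^ 2 * (L : ℝ) ^ 2 / 2) := by ring
  rw [this]
  exact hgap

/-- **The line's residue is exactly the crux.** `MesoscopicPairOrder` (Fejér-box `d`-wave pair order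
`m R² ≤ T_R(ψ)/L²` in EVERY normalised sector ground state, at one `(U, δ)`, arbitrarily large `R`,
all large even `L`) is EQUIVALENT to the stateless chord gap of the box pair repulsion
(`∃ (U, δ), m > 0, ∀R₀ ∃R ≥ R₀ ∃L₀ ∀ even L ≥ L₀ ∃ε > 0: ε m R² L² ≤ E_K(H_L + εK_R) - E_K(H_L)`),
i.e. to the registered load-bearing stub `stub_chordGap` of line `Sketch`
(`chordGap_of_mesoscopicPairOrder`, `mesoscopicPairOrder_of_chordGap`; the margins differ by the
factor `2`, immaterial under `∃ m`). [folklore] -/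
theorem mesoscopicPairOrder_iff_chordGap :
    Summit.HubbardSuperconductivity.HubbardSuperconductivity.Theses.FunctionFieldCertificate.MesoscopicPairOrder ↔
      ∃ U : ℝ, 0 < U ∧ ∃ δ ∈ Set.Ioo (0:ℝ) (1 / 2), ∃ m : ℝ, 0 < m ∧
        ∀ R₀ : ℕ, ∃ R : ℕ, R₀ ≤ R ∧ ∃ L₀ : ℕ, ∀ (L : ℕ) [NeZero L], L₀ ≤ L → Even L → ∃ ε : ℝ, 0 < ε ∧
          ε * (m * (R : ℝ) ^ 2 * (L : ℝ) ^ 2) ≤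
            (hubbardTorus 2 L 1 U + (ε : ℂ) • (∑ x : TorusSite 2 L, ∑ y : TorusSite 2 L,
                ((∏ i : Fin 2, max 0 (1 - |(((y i - x i).valMinAbs : ℤ) : ℝ)| / (R : ℝ)) : ℝ) : ℂ) •
                  ((localPair dWaveFormFactor L x)ᴴ * localPair dWaveFormFactor L y))).minEnergyOn
                (szSector (2 * ⌊(1 - δ) * (L : ℝ) ^ 2 / 2⌋₊) 0) -
              (hubbardTorus 2 L 1 U).minEnergyOn (szSector (2 * ⌊(1 - δ) * (L : ℝ) ^ 2 / 2⌋₊) 0) :=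
  ⟨chordGap_of_mesoscopicPairOrder, mesoscopicPairOrder_of_chordGap⟩

end Hubbard

end Summit.HubbardSuperconductivity.HubbardSuperconductivity.Theorems.FunctionFieldCertificate
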